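import Summits.BirchSwinnertonDyer.BirchSwinnertonDyer.Theorems.SylvesterTwoHeegnerIndexCoupledTelescopeReflectionFrame
import Summits.BirchSwinnertonDyer.BirchSwinnertonDyer.Theorems.SylvesterTwoHeegnerIndexCoupledTelescopeAdmissibleLines
import Literature.NumberTheory.EllipticCurves.CubicTwistTransportJZero
import Literature.NumberTheory.EllipticCurves.KolyvaginClassEndomorphismNaturality
import HarnessLib

/-!
# The COUPLED Cassels–Tate telescope, L: THE REFLECTION OF THE TWISTED TRACE (Gross 1991 Prop. 5.4 (1), `E(K̄)`-level
# half, in Hu–Shu–Yin's CM frame; crux `UpperOffV0HSYPlus`, stmt-BirchSwinnertonDyer-19804; plan (B) SIGNS B-III (F★))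

For the twisted trace `P^χ = Σ_i R(t_i)(t_i P)` of a point `P` whose class mod `n A` is `N₀`-fixed (Gross Prop. 3.6) and
a lift `τ̃` of complex conjugation with the REFLECTION INPUT `τ̃ P = s σ̃ P + T + n Z` (file (R), transported to
`E(K̄)`), the transported point `ψ(P^χ)` on the cubic twist satisfies `τ̃ ψ(P^χ) = s ψ(S P^χ) + ψ T' + n ψ Z'` with `S`
an `x`-scaling by a cube root of unity, `T' ∈ A` torsion, `Z' ∈ A`: Gross's «`{σ⁻¹σ'}` is another set of coset
representatives» with the cubic character `χ` inverted by `τ̃` (`R(τ̃ g τ̃) = R(g)²`).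
* ★ `exists_reflection_chiComponent`.
Theorems only (no definition / named fact / instance / notation); nothing asserted on 19804; no stub closed;
X12.CMAtTwo NOT proved; BSD not claimed for any curve.  Sources: [GrossLMS1991] Prop. 5.4 (1), §12 (y_χ);
[HuShuYin2019] §1 p. 4, §2 p. 8; [McCallumLMS1991] §4 (4).
-/

set_option linter.dupNamespace false -- Summits modules are `Summit.<Summit>.<Problem>…` by design
set_option autoImplicit false

noncomputable section

open scoped Classical

namespace Summit.BirchSwinnertonDyer.BirchSwinnertonDyer.Theorems.SylvesterTwoCMFlip

open WeierstrassCurve Finset NumberField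
open Literature.NumberTheory.EllipticCurves Literature.NumberTheory.EllipticCurves.HuShuYin2019
  Literature.NumberTheory.EllipticCurves.KolyvaginCocycle

variable {K : Type} [Field K] [NumberField K]

/-! ## §3 The reflection of the twisted trace (Gross Prop. 5.4 (1) in the CM frame) -/

section ChiComponent

variable {c : K ≃ₐ[ℚ] K} {τ : AlgebraicClosure K ≃+* AlgebraicClosure K}

set_option maxHeartbeats 1600000 in
/-- ★ **THE REFLECTION OF THE `χ`-COMPONENT** (Gross 1991 Prop. 5.4 (1), `E(K̄)`-level half, in Hu–Shu–Yin's CM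
frame).  Data: a lift `τ̃` of the conjugation `c` of `K ∋ ω` (`c ω = ω²`, `τ̃² = 1`); a `j = 0` curve `E/ℚ` and the
cubic twist transport `ψ : E(K̄) ≃+ W'(K̄)`, `(x, y) ↦ (v² x, v³ y)` with `(τ̃ v)³ = v³ ≠ 0`; a twist family
`R : Γ_K → Aut E(K̄)` by cube-root-of-unity `x`-scalings, multiplicative, trivial on `N₀`, with
`R (τ̃ g τ̃) = R(g)²`; `N₀ ⊴ Γ_K` stable under `τ̃`-conjugation with a finite transversal `t`; a subgroup `A ≤ E(K̄)`
stable under `Γ_K`, `R` and the cube-root scalings; a point `P` whose class mod `n A` is `N₀`-fixed; and the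
REFLECTION INPUT `τ̃ P = s σ̃ P + T + n Z` (`T ∈ A` torsion, `Z ∈ A`; file (R) transported).  Then for the
`χ`-component `P^χ = Σ_i R(t_i)(t_i P)`:  `τ̃ ψ(P^χ) = s ψ(S P^χ) + ψ T' + n ψ Z'` with `S` an `x`-scaling by a cube
root of unity, `T' ∈ A` torsion, `Z' ∈ A` — the class of `ψ(P^χ)` is a `τ̃`-eigenvector up to a CM unit.
[cite: GrossLMS1991, Prop. 5.4 (1) (proof: {σ⁻¹σ'} is another set of coset representatives), §12 (y_χ)]
[cite: HuShuYin2019, §1 p. 4, §2 p. 8] -/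
theorem exists_reflection_chiComponent (hτ : IsLiftOfAut c τ) (hinv : ∀ x, τ (τ x) = x) {ω : K}
    (hω : ω ^ 2 + ω + 1 = 0) (hcω : c ω = ω ^ 2) {E W' : WeierstrassCurve ℚ}
    (ha₁ : E.a₁ = 0) (ha₂ : E.a₂ = 0) (ha₃ : E.a₃ = 0) (ha₄ : E.a₄ = 0)
    {v : AlgebraicClosure K} (hv : v ≠ 0) (hτv : (τ v) ^ 3 = v ^ 3)
    {ψ : geomPoints (E.baseChange K) ≃+ geomPoints (W'.baseChange K)}
    (hψ : ∀ {x y : AlgebraicClosure K}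
      (h : ((E.baseChange K).baseChange (AlgebraicClosure K)).toAffine.Nonsingular x y),
      ∃ h', ψ (Affine.Point.some x y h) = Affine.Point.some (v ^ 2 * x) (v ^ 3 * y) h')
    (R : Field.absoluteGaloisGroup K → geomPoints (E.baseChange K) ≃+ geomPoints (E.baseChange K))
    (hRf : ∀ g, ∃ u : AlgebraicClosure K, u ^ 3 = 1 ∧ ∀ (x y : AlgebraicClosure K)
      (h : ((E.baseChange K).baseChange (AlgebraicClosure K)).toAffine.Nonsingular x y),
      ∃ h', R g (Affine.Point.some x y h) = Affine.Point.some (u * x) y h')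
    (hRmul : ∀ g g' Q, R (g * g') Q = R g (R g' Q))
    (hRconj : ∀ g Q, R (hτ.conjGalCMH g) Q = R g (R g Q))
    (N₀ : Subgroup (Field.absoluteGaloisGroup K)) [N₀.Normal] (hRN₀ : ∀ h ∈ N₀, ∀ Q, R h Q = Q)
    (hN₀τ : ∀ h ∈ N₀, hτ.conjGalCMH h ∈ N₀)
    {ιt : Type} [Fintype ιt] (t : ιt → Field.absoluteGaloisGroup K)
    (ht : Function.Bijective fun i ↦ (t i : Field.absoluteGaloisGroup K ⧸ N₀))
    (A : AddSubgroup (geomPoints (E.baseChange K)))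
    (hAG : ∀ (g : Field.absoluteGaloisGroup K), ∀ a ∈ A, g • a ∈ A) (hAR : ∀ g, ∀ a ∈ A, R g a ∈ A)
    (hAsc : ∀ (S : geomPoints (E.baseChange K) ≃+ geomPoints (E.baseChange K)) (u : AlgebraicClosure K),
      u ^ 3 = 1 → (∀ (x y : AlgebraicClosure K)
        (h : ((E.baseChange K).baseChange (AlgebraicClosure K)).toAffine.Nonsingular x y),
        ∃ h', S (Affine.Point.some x y h) = Affine.Point.some (u * x) y h') → ∀ a ∈ A, S a ∈ A)
    {n : ℤ} {P : geomPoints (E.baseChange K)}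
    (hP : ∀ h ∈ N₀, ∃ a ∈ A, n • a = h • P - P)
    (hrefl : ∃ (s : ℤ) (σ' : Field.absoluteGaloisGroup K), ∃ T ∈ A, IsOfFinAddOrder T ∧ ∃ Z ∈ A,
      hτ.pointsMap E P = s • σ' • P + T + n • Z) :
    ∃ (u : AlgebraicClosure K), u ^ 3 = 1 ∧ ∃ S : geomPoints (E.baseChange K) ≃+ geomPoints (E.baseChange K),
      (∀ (x y : AlgebraicClosure K) (h : ((E.baseChange K).baseChange (AlgebraicClosure K)).toAffine.Nonsingular x y),
        ∃ h', S (Affine.Point.some x y h) = Affine.Point.some (u * x) y h') ∧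
      ∃ (s : ℤ), ∃ T ∈ A, IsOfFinAddOrder T ∧ ∃ Z ∈ A,
        hτ.pointsMap W' (ψ (∑ i, R (t i) (t i • P))) = s • ψ (S (∑ i, R (t i) (t i • P))) + ψ T + n • ψ Z := by
  obtain ⟨s, σ', T, hTA, hT, Z, hZA, hrefl⟩ := hrefl
  -- ### `τ̃` through `ψ`: `τ̃ ψ Q = ψ (ρτ (τ̃ Q))`, `ρτ = [(τ̃v/v)²]`
  obtain ⟨ρτ, hρτ⟩ := JZero.IsLiftOfAut.exists_rho (W := E) (K := K) (τ := τ) ha₁ ha₂ ha₃ ha₄ hv hτv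
  have hψτ : ∀ Q, hτ.pointsMap W' (ψ Q) = ψ (ρτ (hτ.pointsMap E Q)) := fun Q ↦
    JZero.IsLiftOfAut.pointsMap_cubicTwist_of_apply_eq (W := E) (W' := W') hτ hv hτv hψ hρτ Q
  have hu₀ : (τ v / v) ^ 3 = 1 := JZero.div_pow_three_eq_one hv hτv
  have hu₀' : ((τ v / v) ^ 2) ^ 3 = 1 := by rw [← pow_mul, mul_comm, pow_mul, hu₀, one_pow]
  -- ### `τ̃` through `R g` and through the Galois action
  have hRτ : ∀ g Q, hτ.pointsMap E (R g Q) = R g (R g (hτ.pointsMap E Q)) := by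
    intro g Q
    obtain ⟨u, hu3, hu⟩ := hRf g
    have hG := comp_formula (formula_one_mul hu) (formula_one_mul hu)
    exact pointsMap_apply_of_formula hτ (F := R g) (G := fun Q ↦ R g (R g Q)) (map_zero _) (by simp)
      (a := u) (b := 1) (a' := u * u) (b' := 1 * 1) (formula_one_mul hu) hG
      ((lift_apply_of_pow_three_eq_one hτ hω hcω hu3).trans (pow_two u)) (by rw [map_one, one_mul]) Q
  have hGτ : ∀ (g : Field.absoluteGaloisGroup K) Q, hτ.pointsMap E (g • Q) = hτ.conjGalCMH g • hτ.pointsMap E Q := by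
    intro g Q
    rw [← hτ.pointsMap_smul E, hτ.conjGalCMH_conjGalCMH hinv]
  -- ### the `R g` pairwise commute, `R 1 = id`, `R g⁻¹ ∘ R g = id`
  have hRR : ∀ g g' Q, R g (R g' Q) = R g' (R g Q) := by
    intro g g' Q
    obtain ⟨u, -, hu⟩ := hRf g
    obtain ⟨u', -, hu'⟩ := hRf g'
    exact eq_of_formula (F := fun Q ↦ R g (R g' Q)) (G := fun Q ↦ R g' (R g Q)) (by simp) (by simp)
      (comp_formula (formula_one_mul hu') (formula_one_mul hu)) (comp_formula (formula_one_mul hu) (formula_one_mul hu'))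
      (mul_comm _ _) (mul_comm _ _) Q
  have hR1 : ∀ Q, R 1 Q = Q := fun Q ↦ hRN₀ 1 N₀.one_mem Q
  -- ### the conjugated transversal `sᵢ = (τ̃ tᵢ τ̃) σ'`
  obtain ⟨π, hπ⟩ := exists_perm_of_transversals N₀ t (fun i ↦ hτ.conjGalCMH (t i) * σ') ht
    (bijective_conj_mul_transversal N₀ t ht hτ.conjGalCMH.toMonoidHom (hτ.conjGalCMH_conjGalCMH hinv) hN₀τ σ')
  choose h hhN hh using hπ
  choose a haA ha using fun i ↦ hP (h i) (hhN i)
  -- `R(τ̃ tᵢ τ̃) = R(t_{πi}) ∘ R(σ'⁻¹)`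
  have hRc : ∀ i Q, R (hτ.conjGalCMH (t i)) Q = R (σ'⁻¹) (R (t (π i)) Q) := by
    intro i Q
    have e : hτ.conjGalCMH (t i) = t (π i) * h i * σ'⁻¹ := by
      rw [← hh i, mul_inv_cancel_right]
    rw [e, hRmul, hRmul, hRN₀ _ (hhN i), hRR]
  -- ### the per-index identity
  have key : ∀ i, hτ.pointsMap E (R (t i) (t i • P)) =
      s • R (σ'⁻¹) (R (t (π i)) (t (π i) • P)) + R (t i) (R (t i) (hτ.conjGalCMH (t i) • T)) +
        n • (s • R (σ'⁻¹) (R (t (π i)) (t (π i) • a i)) + R (t i) (R (t i) (hτ.conjGalCMH (t i) • Z))) := by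
    intro i
    have hiP : (hτ.conjGalCMH (t i) * σ') • P = t (π i) • P + n • (t (π i) • a i) := by
      rw [hh i, mul_smul, show h i • P = P + n • a i by rw [ha i]; abel, smul_add, smul_comm (t (π i)) n (a i)]
    rw [hRτ, hGτ, hrefl, smul_add, smul_add, smul_comm (hτ.conjGalCMH (t i)) s, ← mul_smul, hiP,
      smul_comm (hτ.conjGalCMH (t i)) n Z, map_add, map_add, map_add, map_add, map_zsmul, map_zsmul,
      map_zsmul, map_zsmul, ← hRconj, hRc, map_add, map_add, map_zsmul, map_zsmul]
    rw [smul_add, zsmul_add, smul_smul, smul_smul, mul_comm s n]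
    abel
  -- ### sum over the transversal and reindex by `π`
  have hsum : hτ.pointsMap E (∑ i, R (t i) (t i • P)) =
      s • R (σ'⁻¹) (∑ i, R (t i) (t i • P)) + ∑ i, R (t i) (R (t i) (hτ.conjGalCMH (t i) • T)) +
        n • (s • R (σ'⁻¹) (∑ i, R (t i) (t i • a (π.symm i))) + ∑ i, R (t i) (R (t i) (hτ.conjGalCMH (t i) • Z))) := by
    rw [map_sum]
    simp_rw [key]
    rw [Finset.sum_add_distrib, Finset.sum_add_distrib, ← Finset.smul_sum, ← Finset.smul_sum, Finset.sum_add_distrib,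
      ← Finset.smul_sum, ← map_sum, ← map_sum,
      Equiv.sum_comp π (fun i ↦ R (t i) (t i • P)),
      show (∑ i, R (t (π i)) (t (π i) • a i)) = ∑ i, R (t i) (t i • a (π.symm i)) from by
        rw [← Equiv.sum_comp π (fun i ↦ R (t i) (t i • a (π.symm i)))]
        simp only [Equiv.symm_apply_apply]]
  -- ### the output
  obtain ⟨u₁, hu₁3, hu₁⟩ := hRf (σ'⁻¹)
  refine ⟨(τ v / v) ^ 2 * u₁, by rw [mul_pow, hu₀', hu₁3, one_mul], (R (σ'⁻¹)).trans ρτ, ?_, s,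
    ρτ (∑ i, R (t i) (R (t i) (hτ.conjGalCMH (t i) • T))), ?_, ?_,
    ρτ (s • R (σ'⁻¹) (∑ i, R (t i) (t i • a (π.symm i))) + ∑ i, R (t i) (R (t i) (hτ.conjGalCMH (t i) • Z))),
    ?_, ?_⟩
  · intro x y hxy
    obtain ⟨h', e⟩ := comp_formula (formula_one_mul hu₁) (formula_one_mul fun x y h ↦ hρτ h) x y hxy
    refine ⟨by rw [one_mul, one_mul] at h'; exact h', ?_⟩
    rw [AddEquiv.trans_apply]
    exact e.trans (Affine.Point.some_eq_some_of_eq rfl (by rw [one_mul, one_mul]))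
  · refine hAsc ρτ _ hu₀' (fun x y h ↦ hρτ h) _ (A.sum_mem fun i _ ↦ hAR _ _ (hAR _ _ (hAG _ _ hTA)))
  · have hmem : ∀ i, R (t i) (R (t i) (hτ.conjGalCMH (t i) • T)) ∈
        AddCommGroup.torsion (geomPoints (E.baseChange K)) := fun i ↦ by
      rw [AddCommGroup.mem_torsion]
      exact (R (t i)).toAddMonoidHom.isOfFinAddOrder ((R (t i)).toAddMonoidHom.isOfFinAddOrder
        ((DistribSMul.toAddMonoidHom _ (hτ.conjGalCMH (t i))).isOfFinAddOrder hT))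
    have hsumT := (AddCommGroup.torsion (geomPoints (E.baseChange K))).sum_mem fun i (_ : i ∈ Finset.univ) ↦ hmem i
    rw [AddCommGroup.mem_torsion] at hsumT
    exact ρτ.toAddMonoidHom.isOfFinAddOrder hsumT
  · refine hAsc ρτ _ hu₀' (fun x y h ↦ hρτ h) _ (A.add_mem (A.zsmul_mem (hAR _ _ (A.sum_mem fun i _ ↦
      hAR _ _ (hAG _ _ (haA _)))) _) (A.sum_mem fun i _ ↦ hAR _ _ (hAR _ _ (hAG _ _ hZA))))
  · rw [hψτ, hsum]
    simp only [map_add, map_zsmul, AddEquiv.trans_apply]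

/-! ## §2 The three CM cases, and the class is admissible (B-IV) -/

/-- The display's `φ' : (x, y) ↦ (ω̄² x, ω̄³ y)` cubes to the identity on points. [cite: SilvermanAEC2009, III.10.1] -/
theorem cm_apply_apply_apply {ω : K} (hω : ω ^ 2 + ω + 1 = 0) {W' : WeierstrassCurve ℚ}
    (φ' : geomPoints (W'.baseChange K) →+ geomPoints (W'.baseChange K))
    (hφ' : ∀ (x y : AlgebraicClosure K)
      (h : ((W'.baseChange K).baseChange (AlgebraicClosure K)).toAffine.Nonsingular x y),
      ∃ h', φ' (Affine.Point.some x y h) =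
        Affine.Point.some (algebraMap K (AlgebraicClosure K) ω ^ 2 * x) (algebraMap K (AlgebraicClosure K) ω ^ 3 * y) h')
    (Y : geomPoints (W'.baseChange K)) : φ' (φ' (φ' Y)) = Y := by
  have hω3 : algebraMap K (AlgebraicClosure K) ω ^ 3 = 1 := by
    rw [← map_pow, show ω ^ 3 = 1 by linear_combination (ω - 1) * hω, map_one]
  have hid : ∀ (x y : AlgebraicClosure K)
      (h : ((W'.baseChange K).baseChange (AlgebraicClosure K)).toAffine.Nonsingular x y),
      ∃ h', id (Affine.Point.some x y h) = Affine.Point.some (1 * x) (1 * y) h' :=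
    fun x y h ↦ ⟨by rwa [one_mul, one_mul], by simp⟩
  refine eq_of_formula (F := fun Y ↦ φ' (φ' (φ' Y))) (G := id) (by simp) rfl
    (comp_formula (F := fun Y ↦ φ' (φ' Y)) (G := φ') (comp_formula (F := φ') (G := φ') hφ' hφ') hφ') hid ?_ ?_ Y
  · calc _ = (algebraMap K (AlgebraicClosure K) ω ^ 3) ^ 2 := by ring
      _ = 1 := by rw [hω3, one_pow]
  · calc _ = (algebraMap K (AlgebraicClosure K) ω ^ 3) ^ 3 := by ring
      _ = 1 := by rw [hω3, one_pow]

/-- **`τ̃ ∘ φ' = φ'² ∘ τ̃`** for the display's CM operator (`τ̃ ω̄² = ω̄⁴`). [cite: GrossLMS1991, §5 (5.1)] -/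
theorem pointsMap_cm_apply (hτ : IsLiftOfAut c τ) {ω : K} (hω : ω ^ 2 + ω + 1 = 0) (hcω : c ω = ω ^ 2)
    {W' : WeierstrassCurve ℚ} (φ' : geomPoints (W'.baseChange K) →+ geomPoints (W'.baseChange K))
    (hφ' : ∀ (x y : AlgebraicClosure K)
      (h : ((W'.baseChange K).baseChange (AlgebraicClosure K)).toAffine.Nonsingular x y),
      ∃ h', φ' (Affine.Point.some x y h) =
        Affine.Point.some (algebraMap K (AlgebraicClosure K) ω ^ 2 * x) (algebraMap K (AlgebraicClosure K) ω ^ 3 * y) h')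
    (Y : geomPoints (W'.baseChange K)) : hτ.pointsMap W' (φ' Y) = φ' (φ' (hτ.pointsMap W' Y)) := by
  have hω3 : algebraMap K (AlgebraicClosure K) ω ^ 3 = 1 := by
    rw [← map_pow, show ω ^ 3 = 1 by linear_combination (ω - 1) * hω, map_one]
  have h2 : (algebraMap K (AlgebraicClosure K) ω ^ 2) ^ 3 = 1 := by
    rw [← pow_mul, mul_comm, pow_mul, hω3, one_pow]
  have h3 : (algebraMap K (AlgebraicClosure K) ω ^ 3) ^ 3 = 1 := by rw [hω3, one_pow]
  exact pointsMap_apply_of_formula hτ (F := φ') (G := fun Y ↦ φ' (φ' Y)) (map_zero _) (by simp) hφ'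
    (comp_formula (F := φ') (G := φ') hφ' hφ') ((lift_apply_of_pow_three_eq_one hτ hω hcω h2).trans (pow_two _))
    ((lift_apply_of_pow_three_eq_one hτ hω hcω h3).trans (pow_two _)) Y

set_option maxHeartbeats 1600000 in
/-- ★★ **THE THREE CM CASES**: in the setting of `exists_reflection_chiComponent`, with the display's CM operator `φ'`
on the twist and `n = 2^M` (`M ≥ 1`) such that `ψ(A)` has no `n`-torsion (admissibility), the reflection of the
transported `χ`-component is `τ̃ ψ(P^χ) = s • φ'^j (ψ P^χ) + n • R` for some `j ∈ {0, 1, 2}`, `R ∈ ψ(A)` (the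
torsion term is `n`-divisible in `ψ(A)`; the cube root of unity is `1`, `ω̄²` or `ω̄ = ω̄⁴`).
[cite: GrossLMS1991, Prop. 5.4 (1), Lemma 4.3] [cite: HuShuYin2019, §1 p. 4] -/
theorem exists_reflection_chiComponent_cases (hτ : IsLiftOfAut c τ) (hinv : ∀ x, τ (τ x) = x) {ω : K}
    (hω : ω ^ 2 + ω + 1 = 0) (hcω : c ω = ω ^ 2) {E W' : WeierstrassCurve ℚ}
    (ha₁ : E.a₁ = 0) (ha₂ : E.a₂ = 0) (ha₃ : E.a₃ = 0) (ha₄ : E.a₄ = 0)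
    {v : AlgebraicClosure K} (hv : v ≠ 0) (hτv : (τ v) ^ 3 = v ^ 3)
    {ψ : geomPoints (E.baseChange K) ≃+ geomPoints (W'.baseChange K)}
    (hψ : ∀ {x y : AlgebraicClosure K}
      (h : ((E.baseChange K).baseChange (AlgebraicClosure K)).toAffine.Nonsingular x y),
      ∃ h', ψ (Affine.Point.some x y h) = Affine.Point.some (v ^ 2 * x) (v ^ 3 * y) h')
    (φ' : geomPoints (W'.baseChange K) →+ geomPoints (W'.baseChange K))
    (hφ' : ∀ (x y : AlgebraicClosure K)
      (h : ((W'.baseChange K).baseChange (AlgebraicClosure K)).toAffine.Nonsingular x y),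
      ∃ h', φ' (Affine.Point.some x y h) =
        Affine.Point.some (algebraMap K (AlgebraicClosure K) ω ^ 2 * x) (algebraMap K (AlgebraicClosure K) ω ^ 3 * y) h')
    (R : Field.absoluteGaloisGroup K → geomPoints (E.baseChange K) ≃+ geomPoints (E.baseChange K))
    (hRf : ∀ g, ∃ u : AlgebraicClosure K, u ^ 3 = 1 ∧ ∀ (x y : AlgebraicClosure K)
      (h : ((E.baseChange K).baseChange (AlgebraicClosure K)).toAffine.Nonsingular x y),
      ∃ h', R g (Affine.Point.some x y h) = Affine.Point.some (u * x) y h')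
    (hRmul : ∀ g g' Q, R (g * g') Q = R g (R g' Q))
    (hRconj : ∀ g Q, R (hτ.conjGalCMH g) Q = R g (R g Q))
    (N₀ : Subgroup (Field.absoluteGaloisGroup K)) [N₀.Normal] (hRN₀ : ∀ h ∈ N₀, ∀ Q, R h Q = Q)
    (hN₀τ : ∀ h ∈ N₀, hτ.conjGalCMH h ∈ N₀)
    {ιt : Type} [Fintype ιt] (t : ιt → Field.absoluteGaloisGroup K)
    (ht : Function.Bijective fun i ↦ (t i : Field.absoluteGaloisGroup K ⧸ N₀))
    (A : AddSubgroup (geomPoints (E.baseChange K)))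
    (hAG : ∀ (g : Field.absoluteGaloisGroup K), ∀ a ∈ A, g • a ∈ A) (hAR : ∀ g, ∀ a ∈ A, R g a ∈ A)
    (hAsc : ∀ (S : geomPoints (E.baseChange K) ≃+ geomPoints (E.baseChange K)) (u : AlgebraicClosure K),
      u ^ 3 = 1 → (∀ (x y : AlgebraicClosure K)
        (h : ((E.baseChange K).baseChange (AlgebraicClosure K)).toAffine.Nonsingular x y),
        ∃ h', S (Affine.Point.some x y h) = Affine.Point.some (u * x) y h') → ∀ a ∈ A, S a ∈ A)
    {M : ℕ} (hM : 1 ≤ M) (nl : ℕ) (hnl : nl = 2 ^ M)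
    (hA2 : ∀ a ∈ A.map ψ.toAddMonoidHom, ((nl : ℕ) : ℤ) • a = 0 → a = 0)
    {P : geomPoints (E.baseChange K)}
    (hP : ∀ h ∈ N₀, ∃ a ∈ A, ((nl : ℕ) : ℤ) • a = h • P - P)
    (hrefl : ∃ (s : ℤ) (σ' : Field.absoluteGaloisGroup K), ∃ T ∈ A, IsOfFinAddOrder T ∧ ∃ Z ∈ A,
      hτ.pointsMap E P = s • σ' • P + T + ((nl : ℕ) : ℤ) • Z) :
    ∃ (s : ℤ), ∃ Rr ∈ A.map ψ.toAddMonoidHom,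
      hτ.pointsMap W' (ψ (∑ i, R (t i) (t i • P))) = s • ψ (∑ i, R (t i) (t i • P)) + ((nl : ℕ) : ℤ) • Rr ∨
      hτ.pointsMap W' (ψ (∑ i, R (t i) (t i • P))) = s • φ' (ψ (∑ i, R (t i) (t i • P))) + ((nl : ℕ) : ℤ) • Rr ∨
      hτ.pointsMap W' (ψ (∑ i, R (t i) (t i • P))) =
        s • φ' (φ' (ψ (∑ i, R (t i) (t i • P)))) + ((nl : ℕ) : ℤ) • Rr := by
  subst hnl
  obtain ⟨u, hu3, S, hS, s, T, hTA, hT, Z, hZA, heq⟩ := exists_reflection_chiComponent hτ hinv hω hcω ha₁ ha₂ ha₃ ha₄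
    hv hτv hψ R hRf hRmul hRconj N₀ hRN₀ hN₀τ t ht A hAG hAR hAsc hP hrefl
  set X := ∑ i, R (t i) (t i • P) with hX
  -- the torsion term is `n`-divisible inside `ψ(A)`
  obtain ⟨R₀, hR₀, hTR₀⟩ := exists_zsmul_eq_of_isOfFinAddOrder_of_admissible (A := A.map ψ.toAddMonoidHom) hM hA2
    (T := ψ T) ⟨T, hTA, rfl⟩ (ψ.toAddMonoidHom.isOfFinAddOrder hT)
  have hω3 : algebraMap K (AlgebraicClosure K) ω ^ 3 = 1 := by
    rw [← map_pow, show ω ^ 3 = 1 by linear_combination (ω - 1) * hω, map_one]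
  refine ⟨s, R₀ + ψ Z, (A.map ψ.toAddMonoidHom).add_mem hR₀ ⟨Z, hZA, rfl⟩, ?_⟩
  have hfin : ∀ (G : geomPoints (E.baseChange K) → geomPoints (W'.baseChange K)), (∀ Q, ψ (S Q) = G Q) →
      hτ.pointsMap W' (ψ X) = s • G X + (((2 ^ M : ℕ) : ℤ)) • (R₀ + ψ Z) := by
    intro G hG
    rw [heq, hG, hTR₀, zsmul_add]; abel
  -- `ψ ∘ S` has formula `(v² u x, v³ y)`
  have hψS := comp_formula (F := S) (G := ψ) (formula_one_mul hS) (fun x y h ↦ hψ h)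
  rcases pow_three_eq_one_cases hω hu3 with rfl | rfl | rfl
  · refine Or.inl (hfin (fun Q ↦ ψ Q) fun Q ↦ ?_)
    exact eq_of_formula (F := fun Q ↦ ψ (S Q)) (G := fun Q ↦ ψ Q) (by simp) (map_zero _) hψS (fun x y h ↦ hψ h)
      (by ring) (by ring) Q
  · -- `u = ω̄ = ω̄⁴`: two CM steps
    refine Or.inr (Or.inr (hfin (fun Q ↦ φ' (φ' (ψ Q))) fun Q ↦ ?_))
    refine eq_of_formula (F := fun Q ↦ ψ (S Q)) (G := fun Q ↦ φ' (φ' (ψ Q))) (by simp) (by simp) hψS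
      (comp_formula (F := ψ) (G := fun Q ↦ φ' (φ' Q)) (fun x y h ↦ hψ h) (comp_formula (F := φ') (G := φ') hφ' hφ')) ?_ ?_ Q
    · linear_combination (-(v ^ 2 * algebraMap K (AlgebraicClosure K) ω)) * hω3
    · linear_combination (-(v ^ 3 * (algebraMap K (AlgebraicClosure K) ω ^ 3 + 1))) * hω3
  · -- `u = ω̄²`: one CM step
    refine Or.inr (Or.inl (hfin (fun Q ↦ φ' (ψ Q)) fun Q ↦ ?_))
    refine eq_of_formula (F := fun Q ↦ ψ (S Q)) (G := fun Q ↦ φ' (ψ Q)) (by simp) (by simp) hψS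
      (comp_formula (F := ψ) (G := φ') (fun x y h ↦ hψ h) hφ') (by ring) ?_ Q
    linear_combination (-(v ^ 3)) * hω3

set_option maxHeartbeats 1600000 in
/-- ★★★ **B-IV: THE KOLYVAGIN CLASS OF A POINT WITH A CM REFLECTION LAW IS ADMISSIBLE** (Gross Prop. 5.4 (2) in the
CM frame).  If `τ̃ Y = s φ'^j Y + n R` (`j ∈ {0,1,2}`, `R ∈ A`) for a point `Y ∈ invPoints Γ_K A n`, `A` admissible and
stable under `τ̃` and the display's CM operator `φ'` (`φ'² + φ' + 1 = 0` on `E[n]` through `fn`), then the Kolyvagin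
class `c(Y)` lies in the rows' `Adm := {x | ∃ y σ-eigen, x ∈ 𝒪y ∧ y ∈ 𝒪x}`: `Q := φ'^{2j} Y` has `τ̃ Q = s Q + n R'`
(`τ̃ φ' = φ'² τ̃`, `φ'³ = 1`), so `σ_* c(Q) = s c(Q)` (`conjAct_kolyvaginClass_eq_smul`) and `c(Q) = w^{2j} c(Y)`
(`resH1Hom_id_kolyvaginClass`). [cite: GrossLMS1991, Prop. 5.4 (2)] [cite: McCallumLMS1991, §4 (6)] -/
theorem kolyvaginClass_mem_admLines_of_reflection_cases (hτ : IsLiftOfAut c τ) {ω : K} (hω : ω ^ 2 + ω + 1 = 0)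
    (hcω : c ω = ω ^ 2) {W' : WeierstrassCurve ℚ}
    (φ' : geomPoints (W'.baseChange K) →+ geomPoints (W'.baseChange K))
    (hφ'G : ∀ (g : Field.absoluteGaloisGroup K) (P : geomPoints (W'.baseChange K)), φ' (g • P) = g • φ' P)
    (hφ' : ∀ (x y : AlgebraicClosure K)
      (h : ((W'.baseChange K).baseChange (AlgebraicClosure K)).toAffine.Nonsingular x y),
      ∃ h', φ' (Affine.Point.some x y h) =
        Affine.Point.some (algebraMap K (AlgebraicClosure K) ω ^ 2 * x) (algebraMap K (AlgebraicClosure K) ω ^ 3 * y) h')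
    {n : ℤ} {hdiv : ∀ P : geomPoints (W'.baseChange K), ∃ Q : geomPoints (W'.baseChange K), n • Q = P}
    {A' : AddSubgroup (geomPoints (W'.baseChange K))} (hA : IsAdmissible (Field.absoluteGaloisGroup K) A' n)
    (hAτ : ∀ a ∈ A', hτ.pointsMap W' a ∈ A') (hAφ : ∀ a ∈ A', φ' a ∈ A')
    (fn : geomTorsion (W'.baseChange K) n →+ geomTorsion (W'.baseChange K) n)
    (hfn : ∀ (g : Field.absoluteGaloisGroup K) (Q : geomTorsion (W'.baseChange K) n),
      fn (ContinuousMonoidHom.id _ g • Q) = g • fn Q)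
    (hcoe : ∀ Q : geomTorsion (W'.baseChange K) n, ((fn Q : geomTorsion (W'.baseChange K) n) :
      geomPoints (W'.baseChange K)) = φ' Q)
    (hrel : ∀ Q, fn (fn Q) + fn Q + Q = 0)
    {Y : geomPoints (W'.baseChange K)} (hY : Y ∈ invPoints (Field.absoluteGaloisGroup K) A' n)
    (hcases : ∃ (s : ℤ), ∃ Rr ∈ A', hτ.pointsMap W' Y = s • Y + n • Rr ∨ hτ.pointsMap W' Y = s • φ' Y + n • Rr ∨
      hτ.pointsMap W' Y = s • φ' (φ' Y) + n • Rr) :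
    kolyvaginClass (W'.baseChange K) n hdiv hA Y hY ∈
      {x : galH1Torsion (W'.baseChange K) n | ∃ y, (∃ ε : ℤ, conjAct W' c n y = ε • y) ∧
        x ∈ AddSubgroup.closure ({y, resH1Hom (ContinuousMonoidHom.id _) fn hfn y} : Set _) ∧
        y ∈ AddSubgroup.closure ({x, resH1Hom (ContinuousMonoidHom.id _) fn hfn x} : Set _)} := by
  set w := resH1Hom (ContinuousMonoidHom.id _) fn hfn with hw_def
  have hw : ∀ x, w (w x) + w x + x = 0 := resH1Hom_id_apply_apply_add _ fn hfn hrel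
  have hτφ : ∀ Z, hτ.pointsMap W' (φ' Z) = φ' (φ' (hτ.pointsMap W' Z)) := pointsMap_cm_apply hτ hω hcω φ' hφ'
  have hφ3 : ∀ Z, φ' (φ' (φ' Z)) = Z := cm_apply_apply_apply hω φ' hφ'
  have hY₁ : φ' Y ∈ invPoints (Field.absoluteGaloisGroup K) A' n := map_mem_invPoints_of_equivariant φ' hφ'G hAφ hY
  have hY₂ : φ' (φ' Y) ∈ invPoints (Field.absoluteGaloisGroup K) A' n :=
    map_mem_invPoints_of_equivariant φ' hφ'G hAφ hY₁
  have hc₁ : w (kolyvaginClass (W'.baseChange K) n hdiv hA Y hY) = kolyvaginClass (W'.baseChange K) n hdiv hA (φ' Y) hY₁ :=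
    resH1Hom_id_kolyvaginClass hA φ' hφ'G fn hfn hcoe hAφ hY hY₁
  have hc₂ : w (kolyvaginClass (W'.baseChange K) n hdiv hA (φ' Y) hY₁) =
      kolyvaginClass (W'.baseChange K) n hdiv hA (φ' (φ' Y)) hY₂ :=
    resH1Hom_id_kolyvaginClass hA φ' hφ'G fn hfn hcoe hAφ hY₁ hY₂
  obtain ⟨s, Rr, hRr, hcase | hcase | hcase⟩ := hcases
  · -- `j = 0`: `c(Y)` itself is an eigenclass
    exact SylvesterTwoCoupledTelescope.mem_admLines_of_eigen w
      ⟨s, conjAct_kolyvaginClass_eq_smul W' hτ hA hAτ hY s ⟨Rr, hRr, hcase⟩⟩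
  · -- `j = 1`: `Q = φ'² Y`, `τ̃ Q = s Q + n φ' R`
    have hQ : hτ.pointsMap W' (φ' (φ' Y)) = s • φ' (φ' Y) + n • φ' Rr := by
      rw [hτφ, hτφ, hφ3, hcase, map_add, map_zsmul, map_zsmul]
    have heig := conjAct_kolyvaginClass_eq_smul (hdiv := hdiv) W' hτ hA hAτ hY₂ s ⟨φ' Rr, hAφ _ hRr, hQ⟩
    refine SylvesterTwoCoupledTelescope.mem_admLines_of_eigen_iterate w hw 2 ⟨s, ?_⟩
    rw [show (w^[2]) (kolyvaginClass (W'.baseChange K) n hdiv hA Y hY) =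
      w (w (kolyvaginClass (W'.baseChange K) n hdiv hA Y hY)) from rfl, hc₁, hc₂]
    exact heig
  · -- `j = 2`: `Q = φ' Y`, `τ̃ Q = s Q + n φ'² R`
    have hQ : hτ.pointsMap W' (φ' Y) = s • φ' Y + n • φ' (φ' Rr) := by
      rw [hτφ, hcase, map_add, map_add, map_zsmul, map_zsmul, map_zsmul, map_zsmul, hφ3 (φ' Y)]
    have heig := conjAct_kolyvaginClass_eq_smul (hdiv := hdiv) W' hτ hA hAτ hY₁ s ⟨φ' (φ' Rr), hAφ _ (hAφ _ hRr), hQ⟩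
    refine SylvesterTwoCoupledTelescope.mem_admLines_of_eigen_iterate w hw 1 ⟨s, ?_⟩
    rw [show (w^[1]) (kolyvaginClass (W'.baseChange K) n hdiv hA Y hY) =
      w (kolyvaginClass (W'.baseChange K) n hdiv hA Y hY) from rfl, hc₁]
    exact heig

end ChiComponent

end Summit.BirchSwinnertonDyer.BirchSwinnertonDyer.Theorems.SylvesterTwoCMFlip

end
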